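import Summits.KontsevichZagierPeriods.KontsevichZagierPeriods.Theorems.RealEllipticSectorKernel.Negative.IsogenyCM66

/-!
# `RealEllipticSectorKernel` (stmt-KontsevichZagierPeriods-10632), negative side: the second-kind isogeny computation on `y² = 4x³ − 44x + 56`

Support lemmas for the cdisprove finding F9b (`Negative/CMPointSecondKind.lean`; commentary in
`Cruxes/RealEllipticSectorKernel/Disproof.lean` §9b). With the rational 2-isogeny `Ψ` of
`Negative/IsogenyCM66.lean` and `M₄ = ∫₀¹ w dw/√(4w − 4w³)`:
* K-side: on `(e₂,2)` the form `(2−x)/((x−1)²√(−f)) = 1/(4Ψ)·1/√(−f)` is the 1:1 pull-back of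
  `dv/(8v√(4v³−4v))` on `(1,∞)` (`integral_Kside`), and it is Hermite-reduced by
  `H = √(−f)/(1−x)` (`Kside_pointwise`, `integral_Hder`), whence `K₁ = K₀ + M₄` (`integral_K1_cm`);
* J-side: on the oval, `(x + 1/(x−2))/√f` is the 2:1 pull-back of `−2w h(w) dw` (`integral_Jside`),
  and `1/((x−2)√f)` is Hermite-reduced by `G = √f/(2(x−2))` (`integral_inv_sub_two`), whence
  `J₁ = J₀ − 2M₄` (`integral_J1_cm`);
* with `J₀ = 2K₀`: **`2J₀ − J₁ − 2K₁ = 0`** (`second_relation_cm`), the quasi-period CM relation with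
  RATIONAL coefficients at `j = 66³`, no transcendence input.

Sources: M. Kontsevich, D. Zagier, *Periods* (2001), §§1.1–1.2; J. Vélu, *Isogénies entre courbes
elliptiques*, C. R. Acad. Sci. Paris 273 (1971) 238–241; D. Masser, *Elliptic Functions and
Transcendence*, LNM 437 (1975), Ch. III, Lemma 3.1 (CM quasi-period relations). -/

noncomputable section

namespace Summit.KontsevichZagierPeriods.RealEllipticSectorKernel.CM66

open MeasureTheory Set

/-- `M₄ = ∫₀¹ w dw/√(4w − 4w³)` (a lemniscatic integral of the second kind). [folklore] -/
def M₄ : ℝ := ∫ w in Ioo (0:ℝ) 1, w * hI w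

/-- integrability of `(√(−f))⁻¹` on `(e₂, 2)` (transported from `gI` on `(1,∞)`). [folklore] -/
theorem integrableOn_invSqrt_neg : IntegrableOn (fun x => (Real.sqrt (-fcm x))⁻¹) (Ioo e₂ 2) := by
  have hder : ∀ x ∈ Ioo e₂ 2, HasDerivWithinAt Ψ (Ψ' x) (Ioo e₂ 2) x := fun x hx =>
    (hasDerivAt_Ψ hx.2.ne).hasDerivWithinAt
  have hint := integrableOn_image_iff_integrableOn_abs_deriv_smul measurableSet_Ioo hder Ψ_injOn₁ gI
  rw [Ψ_image₁] at hint
  have h2 := (hint.mp integrableOn_gI_Ioi).congr_fun (fun x hx => weight_neg hx.1 hx.2) measurableSet_Ioo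
  have h3 : IntegrableOn (fun x => 1 / 2 * (2 * (Real.sqrt (-fcm x))⁻¹)) (Ioo e₂ 2) := h2.const_mul (1 / 2)
  exact h3.congr_fun (fun x _ => by ring) measurableSet_Ioo

/-- inversion for the second kind: `∫₁^∞ g(v)/v dv = M₄`. [folklore] -/
theorem integral_gI_div : ∫ v in Ioi (1:ℝ), v⁻¹ * gI v = M₄ := by
  have key := integral_image_eq_integral_abs_deriv_smul (s := Ioi (1:ℝ)) (f := fun v : ℝ => v⁻¹)
    (f' := fun v => -(v ^ 2)⁻¹) measurableSet_Ioi
    (fun v hv => (hasDerivAt_inv' (by simp only [mem_Ioi] at hv; linarith)).hasDerivWithinAt)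
    (fun a ha b hb hab => inv_injective hab) (fun w => w * hI w)
  rw [image_inv_Ioi_one] at key
  unfold M₄
  rw [key]
  refine setIntegral_congr_fun measurableSet_Ioi (fun v hv => ?_)
  have hv : 1 < v := hv
  have h := inv_weight hv
  simp only [smul_eq_mul] at h ⊢
  rw [← h]
  ring

/-- weight for the K-side second-kind substitution: `|Ψ'|·g(Ψ)/(8Ψ) = (2−x)/((x−1)²√(−f))`. [folklore] -/
theorem weight_negK {x : ℝ} (h2 : e₂ < x) (hx2 : x < 2) :
    |Ψ' x| • ((Ψ x)⁻¹ * gI (Ψ x) / 8) = (2 - x) / (x - 1) ^ 2 * (Real.sqrt (-fcm x))⁻¹ := by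
  have hw := weight_neg h2 hx2
  rw [smul_eq_mul] at hw ⊢
  have hx1 : x - 1 ≠ 0 := by linarith [one_lt_e₂]
  have hx2' : x - 2 ≠ 0 := by linarith
  have hΨ : Ψ x = -((x - 1) ^ 2) / (4 * (x - 2)) := Ψ_eq hx2.ne
  have hinv : (Ψ x)⁻¹ = 4 * (2 - x) / (x - 1) ^ 2 := by
    rw [hΨ]
    have : (x - 1) ^ 2 ≠ 0 := pow_ne_zero 2 hx1
    field_simp
    ring
  calc |Ψ' x| * ((Ψ x)⁻¹ * gI (Ψ x) / 8) = (Ψ x)⁻¹ / 8 * (|Ψ' x| * gI (Ψ x)) := by ring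
    _ = (Ψ x)⁻¹ / 8 * (2 * (Real.sqrt (-fcm x))⁻¹) := by rw [hw]
    _ = (2 - x) / (x - 1) ^ 2 * (Real.sqrt (-fcm x))⁻¹ := by rw [hinv]; ring

/-- the K-side substitution: `∫_(e₂,2) (2−x)/((x−1)²√(−f)) dx = M₄/8`. [folklore] -/
theorem integral_Kside : ∫ x in Ioo e₂ 2, (2 - x) / (x - 1) ^ 2 * (Real.sqrt (-fcm x))⁻¹ = M₄ / 8 := by
  have key := integral_image_eq_integral_abs_deriv_smul (s := Ioo e₂ 2) (f := Ψ) (f' := Ψ')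
    measurableSet_Ioo (fun x hx => (hasDerivAt_Ψ hx.2.ne).hasDerivWithinAt) Ψ_injOn₁
    (fun v => v⁻¹ * gI v / 8)
  rw [Ψ_image₁, setIntegral_congr_fun measurableSet_Ioo (fun x hx => weight_negK hx.1 hx.2)] at key
  rw [← key]
  have : ∫ v in Ioi (1:ℝ), v⁻¹ * gI v / 8 = (∫ v in Ioi (1:ℝ), v⁻¹ * gI v) / 8 := by
    rw [← integral_div]
  rw [this, integral_gI_div]

/-- derivative of the cubic. [folklore] -/
theorem hasDerivAt_fcm (x : ℝ) : HasDerivAt fcm (12 * x ^ 2 - 44) x := by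
  have h1 : HasDerivAt (fun y : ℝ => y ^ 3) (3 * x ^ 2) x := by simpa using hasDerivAt_pow 3 x
  have h := ((h1.const_mul 4).sub ((hasDerivAt_id x).const_mul 44)).add_const 56
  exact (h.congr_deriv (by ring)).congr_of_eventuallyEq
    (Filter.Eventually.of_forall fun y => by simp [fcm])

/-- `H(x) = √(−f x)/(1 − x)`. [folklore] -/
def Hfun (x : ℝ) : ℝ := Real.sqrt (-fcm x) / (1 - x)

/-- `H′(x) = −2((1−x) + 8/(1−x) + 8/(1−x)²)/√(−f x)` on `(e₂, 2)`. [folklore] -/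
def Hder (x : ℝ) : ℝ := -2 * ((1 - x) + 8 / (1 - x) + 8 / (1 - x) ^ 2) * (Real.sqrt (-fcm x))⁻¹

/-- Auxiliary step of the second-kind isogeny computation (F9b). [folklore] -/
theorem hasDerivAt_Hfun {x : ℝ} (h2 : e₂ < x) (hx2 : x < 2) : HasDerivAt Hfun (Hder x) x := by
  have hfneg : 0 < -fcm x := by linarith [fcm_neg_of_mem h2 hx2]
  set r := Real.sqrt (-fcm x) with hr
  have hr0 : 0 < r := Real.sqrt_pos.mpr hfneg
  have hrr : r * r = -fcm x := Real.mul_self_sqrt hfneg.le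
  have hs : 1 - x ≠ 0 := by linarith [one_lt_e₂]
  have h1 : HasDerivAt (fun y => -fcm y) (-(12 * x ^ 2 - 44)) x := (hasDerivAt_fcm x).neg
  have h2' : HasDerivAt (fun y => Real.sqrt (-fcm y)) (-(12 * x ^ 2 - 44) / (2 * r)) x := by
    have := h1.sqrt hfneg.ne'
    simpa [hr] using this
  have h3 : HasDerivAt (fun y : ℝ => 1 - y) (-1) x := by
    simpa using (hasDerivAt_id x).const_sub 1
  have h4 := h2'.div h3 hs
  refine h4.congr_deriv ?_
  -- algebra: ((-f')/(2r) (1-x) - r (-1)) / (1-x)^2 = Hder x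
  have hnum : -(12 * x ^ 2 - 44) * (1 - x) + 2 * (r * r) = -4 * ((1 - x) ^ 3 + 8 * (1 - x) + 8) := by
    rw [hrr]; unfold fcm; ring
  unfold Hder
  rw [← hr]
  field_simp
  linear_combination hnum

/-- Auxiliary step of the second-kind isogeny computation (F9b). [folklore] -/
theorem Hfun_two : Hfun 2 = 0 := by
  unfold Hfun fcm; norm_num

/-- Auxiliary step of the second-kind isogeny computation (F9b). [folklore] -/
theorem Hfun_e₂ : Hfun e₂ = 0 := by
  unfold Hfun
  have : fcm e₂ = 0 := by rw [fcm_factor]; ring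
  rw [this]; simp

/-- Auxiliary step of the second-kind isogeny computation (F9b). [folklore] -/
theorem continuousOn_Hfun : ContinuousOn Hfun (Icc e₂ 2) := by
  unfold Hfun
  refine ContinuousOn.div ?_ ?_ (fun x hx => by linarith [hx.1, one_lt_e₂])
  · have : Continuous fun x => Real.sqrt (-fcm x) := by unfold fcm; fun_prop
    exact this.continuousOn
  · fun_prop

/-- integrability of `(√(−f))⁻¹` on the closed interval. [folklore] -/
theorem integrableOn_invSqrt_neg_Icc : IntegrableOn (fun x => (Real.sqrt (-fcm x))⁻¹) (Icc e₂ 2) :=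
  (integrableOn_Icc_iff_integrableOn_Ioo).mpr integrableOn_invSqrt_neg

/-- products of `(√(−f))⁻¹` with functions continuous on `[e₂,2]` are integrable. [folklore] -/
theorem integrableOn_mul_invSqrt_neg {φ : ℝ → ℝ} (hφ : ContinuousOn φ (Icc e₂ 2)) :
    IntegrableOn (fun x => φ x * (Real.sqrt (-fcm x))⁻¹) (Ioo e₂ 2) :=
  (integrableOn_invSqrt_neg_Icc.continuousOn_mul hφ isCompact_Icc).mono_set Ioo_subset_Icc_self

/-- Auxiliary step of the second-kind isogeny computation (F9b). [folklore] -/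
theorem integrableOn_Hder : IntegrableOn Hder (Ioo e₂ 2) := by
  unfold Hder
  refine integrableOn_mul_invSqrt_neg ?_
  have h : ∀ x ∈ Icc e₂ 2, 1 - x ≠ 0 := fun x hx => by linarith [hx.1, one_lt_e₂]
  refine ContinuousOn.mul continuousOn_const (ContinuousOn.add (ContinuousOn.add (by fun_prop) ?_) ?_)
  · exact continuousOn_const.div (by fun_prop) h
  · exact continuousOn_const.div (by fun_prop) (fun x hx => pow_ne_zero 2 (h x hx))

/-- Newton–Leibniz on `[e₂, 2]`: `∫ H′ = H(2) − H(e₂) = 0`. [folklore] -/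
theorem integral_Hder : ∫ x in Ioo e₂ 2, Hder x = 0 := by
  have hftc := intervalIntegral.integral_eq_sub_of_hasDerivAt_of_le e₂_lt_two.le continuousOn_Hfun
    (fun x hx => hasDerivAt_Hfun hx.1 hx.2)
    ((intervalIntegrable_iff_integrableOn_Ioo_of_le e₂_lt_two.le).mpr integrableOn_Hder)
  rw [Hfun_two, Hfun_e₂, sub_zero, intervalIntegral.integral_of_le e₂_lt_two.le,
    integral_Ioc_eq_integral_Ioo] at hftc
  exact hftc

/-- the pointwise second-kind identity on `(e₂,2)`:
`(2−x)/((x−1)²√(−f)) = −H′/16 − (1−x)/(8√(−f))`. [folklore] -/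
theorem Kside_pointwise {x : ℝ} (h2 : e₂ < x) :
    (2 - x) / (x - 1) ^ 2 * (Real.sqrt (-fcm x))⁻¹ =
      -(Hder x) / 16 - (1 - x) * (Real.sqrt (-fcm x))⁻¹ / 8 := by
  have hs : 1 - x ≠ 0 := by linarith [one_lt_e₂]
  have hs' : x - 1 ≠ 0 := by linarith [one_lt_e₂]
  unfold Hder
  field_simp
  ring

/-- `K₁ − K₀ = M₄` in the form `∫ x/√(−f) = Λ/4 + M₄`. [folklore] -/
theorem integral_K1_cm : ∫ x in Ioo e₂ 2, x * (Real.sqrt (-fcm x))⁻¹ = lemHalf / 2 + M₄ := by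
  have hK := integral_Kside
  rw [setIntegral_congr_fun measurableSet_Ioo (fun x hx => Kside_pointwise hx.1)] at hK
  have i1 : IntegrableOn (fun x => -(Hder x) / 16) (Ioo e₂ 2) := by
    have := (integrableOn_Hder.neg).div_const 16
    exact this
  have i2 : IntegrableOn (fun x => (1 - x) * (Real.sqrt (-fcm x))⁻¹ / 8) (Ioo e₂ 2) :=
    (integrableOn_mul_invSqrt_neg (by fun_prop)).div_const 8
  rw [integral_sub i1 i2] at hK
  have e1 : ∫ x in Ioo e₂ 2, -(Hder x) / 16 = 0 := by
    rw [integral_div, integral_neg, integral_Hder]; simp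
  have i3 : IntegrableOn (fun x => (Real.sqrt (-fcm x))⁻¹) (Ioo e₂ 2) := integrableOn_invSqrt_neg
  have i4 : IntegrableOn (fun x => x * (Real.sqrt (-fcm x))⁻¹) (Ioo e₂ 2) :=
    integrableOn_mul_invSqrt_neg (by fun_prop)
  have e2 : ∫ x in Ioo e₂ 2, (1 - x) * (Real.sqrt (-fcm x))⁻¹ / 8 =
      ((∫ x in Ioo e₂ 2, (Real.sqrt (-fcm x))⁻¹) - ∫ x in Ioo e₂ 2, x * (Real.sqrt (-fcm x))⁻¹) / 8 := by
    rw [integral_div, ← integral_sub i3 i4]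
    congr 1
    refine integral_congr_ae (Filter.Eventually.of_forall fun x => ?_)
    ring
  rw [e1, e2, integral_K_cm] at hK
  linarith

/-- integrability of `(√f)⁻¹` on the bounded oval. [folklore] -/
theorem integrableOn_invSqrt_pos : IntegrableOn (fun x => (Real.sqrt (fcm x))⁻¹) (Ioo e₃ e₂) := by
  obtain ⟨-, hi₂⟩ := integral_J_half measurableSet_Ioo Ψ_image₂ Ψ_injOn₂
    (fun x hx => ⟨hx.1, hx.2.trans one_lt_e₂, hx.2.ne⟩)
  obtain ⟨-, hi₃⟩ := integral_J_half measurableSet_Ioo Ψ_image₃ Ψ_injOn₃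
    (fun x hx => ⟨e₃_lt_one.trans hx.1, hx.2, hx.1.ne'⟩)
  have h2 : IntegrableOn (fun x => (Real.sqrt (fcm x))⁻¹) (Icc e₃ 1) :=
    (integrableOn_Icc_iff_integrableOn_Ioo).mpr hi₂
  have h3 : IntegrableOn (fun x => (Real.sqrt (fcm x))⁻¹) (Icc 1 e₂) :=
    (integrableOn_Icc_iff_integrableOn_Ioo).mpr hi₃
  have h4 := h2.union h3
  rw [Icc_union_Icc_eq_Icc e₃_lt_one.le one_lt_e₂.le] at h4
  exact h4.mono_set Ioo_subset_Icc_self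

/-- … and on the closed oval. [folklore] -/
theorem integrableOn_invSqrt_pos_Icc : IntegrableOn (fun x => (Real.sqrt (fcm x))⁻¹) (Icc e₃ e₂) :=
  (integrableOn_Icc_iff_integrableOn_Ioo).mpr integrableOn_invSqrt_pos

/-- products of `(√f)⁻¹` with functions continuous on `[e₃,e₂]` are integrable on the oval. [folklore] -/
theorem integrableOn_mul_invSqrt_pos {φ : ℝ → ℝ} (hφ : ContinuousOn φ (Icc e₃ e₂)) :
    IntegrableOn (fun x => φ x * (Real.sqrt (fcm x))⁻¹) (Ioo e₃ e₂) :=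
  (integrableOn_invSqrt_pos_Icc.continuousOn_mul hφ isCompact_Icc).mono_set Ioo_subset_Icc_self

/-- `G(x) = √(f x)/(2(x − 2))`. [folklore] -/
def Gfun (x : ℝ) : ℝ := Real.sqrt (fcm x) / (2 * (x - 2))

/-- `G′(x) = ((x−2) − 1/(x−2))/√(f x)` on the oval. [folklore] -/
def Gder (x : ℝ) : ℝ := ((x - 2) - (x - 2)⁻¹) * (Real.sqrt (fcm x))⁻¹

/-- Auxiliary step of the second-kind isogeny computation (F9b). [folklore] -/
theorem hasDerivAt_Gfun {x : ℝ} (h3 : e₃ < x) (h2 : x < e₂) : HasDerivAt Gfun (Gder x) x := by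
  have hfpos : 0 < fcm x := fcm_pos_of_mem h3 h2
  set r := Real.sqrt (fcm x) with hr
  have hr0 : 0 < r := Real.sqrt_pos.mpr hfpos
  have hrr : r * r = fcm x := Real.mul_self_sqrt hfpos.le
  have hx2 : x - 2 ≠ 0 := by linarith [e₂_lt_two]
  have hv : 2 * (x - 2) ≠ 0 := mul_ne_zero two_ne_zero hx2
  have h1 : HasDerivAt (fun y => Real.sqrt (fcm y)) ((12 * x ^ 2 - 44) / (2 * r)) x := by
    have := (hasDerivAt_fcm x).sqrt hfpos.ne'
    simpa [hr] using this
  have h3' : HasDerivAt (fun y : ℝ => 2 * (y - 2)) 2 x := by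
    simpa using ((hasDerivAt_id x).sub_const 2).const_mul 2
  have h4 := h1.div h3' hv
  refine h4.congr_deriv ?_
  have hrr' : r * r = 4 * x ^ 3 - 44 * x + 56 := by rw [hrr]; rfl
  have hnum : (12 * x ^ 2 - 44) * (2 * (x - 2)) - 2 * (r * r) * 2 =
      8 * (x - 2) * ((x - 2) ^ 2 - 1) := by
    rw [hrr']; ring
  unfold Gder
  rw [← hr]
  field_simp
  linear_combination hnum + 2 * hrr'

/-- Auxiliary step of the second-kind isogeny computation (F9b). [folklore] -/
theorem Gfun_e₂ : Gfun e₂ = 0 := by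
  unfold Gfun
  have : fcm e₂ = 0 := by rw [fcm_factor]; ring
  rw [this]; simp

/-- Auxiliary step of the second-kind isogeny computation (F9b). [folklore] -/
theorem Gfun_e₃ : Gfun e₃ = 0 := by
  unfold Gfun
  have : fcm e₃ = 0 := by rw [fcm_factor]; ring
  rw [this]; simp

/-- Auxiliary step of the second-kind isogeny computation (F9b). [folklore] -/
theorem continuousOn_Gfun : ContinuousOn Gfun (Icc e₃ e₂) := by
  unfold Gfun
  refine ContinuousOn.div ?_ (by fun_prop) (fun x hx => ?_)
  · have : Continuous fun x => Real.sqrt (fcm x) := by unfold fcm; fun_prop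
    exact this.continuousOn
  · have : x - 2 ≠ 0 := by linarith [hx.2, e₂_lt_two]
    exact mul_ne_zero two_ne_zero this

/-- Auxiliary step of the second-kind isogeny computation (F9b). [folklore] -/
theorem integrableOn_Gder : IntegrableOn Gder (Ioo e₃ e₂) := by
  unfold Gder
  refine integrableOn_mul_invSqrt_pos (ContinuousOn.sub (by fun_prop) ?_)
  exact ContinuousOn.inv₀ (by fun_prop) (fun x hx => by linarith [hx.2, e₂_lt_two])

/-- Newton–Leibniz on `[e₃, e₂]`: `∫ G′ = 0`. [folklore] -/
theorem integral_Gder : ∫ x in Ioo e₃ e₂, Gder x = 0 := by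
  have hftc := intervalIntegral.integral_eq_sub_of_hasDerivAt_of_le e₃_lt_e₂.le continuousOn_Gfun
    (fun x hx => hasDerivAt_Gfun hx.1 hx.2)
    ((intervalIntegrable_iff_integrableOn_Ioo_of_le e₃_lt_e₂.le).mpr integrableOn_Gder)
  rw [Gfun_e₂, Gfun_e₃, sub_zero, intervalIntegral.integral_of_le e₃_lt_e₂.le,
    integral_Ioc_eq_integral_Ioo] at hftc
  exact hftc

/-- `∫_oval dx/((x−2)√f) = J₁ − 2J₀` (Hermite-type reduction of the form with a pole at the
rational 2-torsion point). [folklore] -/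
theorem integral_inv_sub_two :
    ∫ x in Ioo e₃ e₂, (x - 2)⁻¹ * (Real.sqrt (fcm x))⁻¹ =
      (∫ x in Ioo e₃ e₂, x * (Real.sqrt (fcm x))⁻¹) - 2 * ∫ x in Ioo e₃ e₂, (Real.sqrt (fcm x))⁻¹ := by
  have hpt : EqOn (fun x => (x - 2)⁻¹ * (Real.sqrt (fcm x))⁻¹)
      (fun x => (x - 2) * (Real.sqrt (fcm x))⁻¹ - Gder x) (Ioo e₃ e₂) := by
    intro x _
    simp only [Gder]
    ring
  rw [setIntegral_congr_fun measurableSet_Ioo hpt,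
    integral_sub (integrableOn_mul_invSqrt_pos (by fun_prop)) integrableOn_Gder, integral_Gder,
    sub_zero]
  have hpt2 : EqOn (fun x => (x - 2) * (Real.sqrt (fcm x))⁻¹)
      (fun x => x * (Real.sqrt (fcm x))⁻¹ - 2 * (Real.sqrt (fcm x))⁻¹) (Ioo e₃ e₂) := by
    intro x _; ring
  rw [setIntegral_congr_fun measurableSet_Ioo hpt2,
    integral_sub (integrableOn_mul_invSqrt_pos (by fun_prop))
      (integrableOn_mul_invSqrt_pos (by fun_prop)), integral_const_mul]

/-- weight for the J-side second-kind substitution: `|Ψ'|·(−2Ψ h(Ψ)) = (x + 1/(x−2))/√f`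
(the pull-back of `u du/Y′` along the isogeny). [folklore] -/
theorem weight_posJ {x : ℝ} (h3 : e₃ < x) (h2 : x < e₂) (hx1 : x ≠ 1) :
    |Ψ' x| • (-2 * Ψ x * hI (Ψ x)) = (x + (x - 2)⁻¹) * (Real.sqrt (fcm x))⁻¹ := by
  have hw := weight_pos h3 h2 hx1
  rw [smul_eq_mul] at hw ⊢
  have hx2 : x - 2 ≠ 0 := by linarith [e₂_lt_two]
  have hΨ : -4 * Ψ x = x + (x - 2)⁻¹ := by unfold Ψ; ring
  calc |Ψ' x| * (-2 * Ψ x * hI (Ψ x)) = -2 * Ψ x * (|Ψ' x| * hI (Ψ x)) := by ring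
    _ = -2 * Ψ x * (2 * (Real.sqrt (fcm x))⁻¹) := by rw [hw]
    _ = (x + (x - 2)⁻¹) * (Real.sqrt (fcm x))⁻¹ := by rw [← hΨ]; ring

/-- Auxiliary step of the second-kind isogeny computation (F9b). [folklore] -/
theorem integrableOn_G₂ : IntegrableOn (fun w => -2 * w * hI w) (Ioo (0:ℝ) 1) := by
  have h1 : IntegrableOn hI (Icc (0:ℝ) 1) := (integrableOn_Icc_iff_integrableOn_Ioo).mpr integrableOn_hI_Ioo
  have h2 : IntegrableOn (fun w : ℝ => (-2 * w) * hI w) (Icc (0:ℝ) 1) :=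
    h1.continuousOn_mul (by fun_prop) isCompact_Icc
  exact h2.mono_set Ioo_subset_Icc_self

/-- Auxiliary step of the second-kind isogeny computation (F9b). [folklore] -/
theorem integral_G₂ : ∫ w in Ioo (0:ℝ) 1, -2 * w * hI w = -2 * M₄ := by
  unfold M₄
  rw [← integral_const_mul]
  refine integral_congr_ae (Filter.Eventually.of_forall fun w => ?_)
  ring

/-- Auxiliary step of the second-kind isogeny computation (F9b). [folklore] -/
theorem integral_Jside_half {S : Set ℝ} (hS : MeasurableSet S) (himg : Ψ '' S = Ioo 0 1)
    (hinj : InjOn Ψ S) (hS2 : ∀ x ∈ S, e₃ < x ∧ x < e₂ ∧ x ≠ 1) :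
    ∫ x in S, (x + (x - 2)⁻¹) * (Real.sqrt (fcm x))⁻¹ = -2 * M₄ ∧
      IntegrableOn (fun x => (x + (x - 2)⁻¹) * (Real.sqrt (fcm x))⁻¹) S := by
  have hder : ∀ x ∈ S, HasDerivWithinAt Ψ (Ψ' x) S x := fun x hx =>
    (hasDerivAt_Ψ ((hS2 x hx).2.1.trans e₂_lt_two).ne).hasDerivWithinAt
  have hw : EqOn (fun x => |Ψ' x| • (-2 * Ψ x * hI (Ψ x)))
      (fun x => (x + (x - 2)⁻¹) * (Real.sqrt (fcm x))⁻¹) S :=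
    fun x hx => weight_posJ (hS2 x hx).1 (hS2 x hx).2.1 (hS2 x hx).2.2
  have key := integral_image_eq_integral_abs_deriv_smul hS hder hinj (fun w => -2 * w * hI w)
  rw [himg, integral_G₂, setIntegral_congr_fun hS hw] at key
  have hint := integrableOn_image_iff_integrableOn_abs_deriv_smul hS hder hinj (fun w => -2 * w * hI w)
  rw [himg] at hint
  exact ⟨key.symm, (hint.mp integrableOn_G₂).congr_fun hw hS⟩

/-- the J-side substitution: `∫_oval (x + 1/(x−2)) dx/√f = −4M₄` (2:1 cover of `(−4,0)`). [folklore] -/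
theorem integral_Jside : ∫ x in Ioo e₃ e₂, (x + (x - 2)⁻¹) * (Real.sqrt (fcm x))⁻¹ = -4 * M₄ := by
  obtain ⟨hI₂, hi₂⟩ := integral_Jside_half measurableSet_Ioo Ψ_image₂ Ψ_injOn₂
    (fun x hx => ⟨hx.1, hx.2.trans one_lt_e₂, hx.2.ne⟩)
  obtain ⟨hI₃, hi₃⟩ := integral_Jside_half measurableSet_Ioo Ψ_image₃ Ψ_injOn₃
    (fun x hx => ⟨e₃_lt_one.trans hx.1, hx.2, hx.1.ne'⟩)
  have hsplit : Ioo e₃ e₂ \ {1} = Ioo e₃ 1 ∪ Ioo 1 e₂ := by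
    ext x
    simp only [mem_sdiff, mem_Ioo, mem_singleton_iff, mem_union]
    constructor
    · rintro ⟨⟨h1, h2⟩, h3⟩
      rcases lt_or_gt_of_ne h3 with h | h
      · exact Or.inl ⟨h1, h⟩
      · exact Or.inr ⟨h, h2⟩
    · rintro (⟨h1, h2⟩ | ⟨h1, h2⟩)
      · exact ⟨⟨h1, h2.trans one_lt_e₂⟩, h2.ne⟩
      · exact ⟨⟨e₃_lt_one.trans h1, h2⟩, h1.ne'⟩
  have hae : (Ioo e₃ e₂ \ {1} : Set ℝ) =ᵐ[volume] Ioo e₃ e₂ := sdiff_null_ae_eq_self (by simp)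
  rw [← setIntegral_congr_set hae, hsplit,
    setIntegral_union (Set.disjoint_left.mpr fun x hx hx' => lt_irrefl x (hx.2.trans hx'.1))
      measurableSet_Ioo hi₂ hi₃, hI₂, hI₃]
  ring

/-- `J₁ = J₀ − 2M₄`. [folklore] -/
theorem integral_J1_cm : ∫ x in Ioo e₃ e₂, x * (Real.sqrt (fcm x))⁻¹ = lemHalf - 2 * M₄ := by
  have h := integral_Jside
  have hpt : EqOn (fun x => (x + (x - 2)⁻¹) * (Real.sqrt (fcm x))⁻¹)
      (fun x => x * (Real.sqrt (fcm x))⁻¹ + (x - 2)⁻¹ * (Real.sqrt (fcm x))⁻¹) (Ioo e₃ e₂) := by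
    intro x _; ring
  have hi1 : IntegrableOn (fun x => x * (Real.sqrt (fcm x))⁻¹) (Ioo e₃ e₂) :=
    integrableOn_mul_invSqrt_pos (by fun_prop)
  have hi2 : IntegrableOn (fun x => (x - 2)⁻¹ * (Real.sqrt (fcm x))⁻¹) (Ioo e₃ e₂) :=
    integrableOn_mul_invSqrt_pos (ContinuousOn.inv₀ (by fun_prop) (fun x hx => by linarith [hx.2, e₂_lt_two]))
  rw [setIntegral_congr_fun measurableSet_Ioo hpt, integral_add hi1 hi2, integral_inv_sub_two,
    integral_J_cm] at h
  linarith

/-- **The second integer period relation at `j = 66³`: `2J₀ − J₁ − 2K₁ = 0`.** [folklore] -/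
theorem second_relation_cm :
    2 * (∫ x in Ioo e₃ e₂, (Real.sqrt (fcm x))⁻¹) - (∫ x in Ioo e₃ e₂, x * (Real.sqrt (fcm x))⁻¹)
      - 2 * (∫ x in Ioo e₂ 2, x * (Real.sqrt (-fcm x))⁻¹) = 0 := by
  rw [integral_J_cm, integral_J1_cm, integral_K1_cm]; ring

end Summit.KontsevichZagierPeriods.RealEllipticSectorKernel.CM66

end
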